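import Literature.IUT.LogVolume.TensorPacketVolume
import HarnessLib

/-!
# Theta-twists at different tensor slots: equal sizes give the SAME region, different sizes a NESTED pair
# ([IUTchIV] Thm. 1.10 Step (v)'s "symmetrizing with respect to the choice of i†", on the real packet)

Mochizuki, *Inter-universal Teichmüller theory IV*, proof of Thm. 1.10, Step (v) (kurims Apr-2020 ms
p. 27–28): the collection `{v_i}_{i∈S±_{j+1}}` of "[not necessarily distinct!]" places, the exponent "`λ`"
read off the theta value `q_{v_j}^{j²}` of the DISTINGUISHED slot `i† = j`, and «we note that, unlike the
other terms …, "`λ`" is asymmetric with respect to the choice of "`i† ∈ I`" in `S±_{j+1}` … after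
symmetrizing with respect to the choice of "`i† ∈ I`" … it follows immediately from … Proposition 1.7
that, after passing to weighted averages, the operation of symmetrizing … does not affect the computation
of the upper bound under consideration». Under (Ind1) (capsule permutations, [IUTchI] Def 4.10 /
Prop 4.11 (i); Dupuy–Hilado §4.7) the component of the union of possible images at a collection contains
the Θ-region twisted at EVERY slot by the theta value of the place sitting in that slot (the cell's audit
note HOME/plan/c312/STEPV-IND1-NOTE.md; DH-interface form `MultiradialRegionInd1Bound.lean`).

This proof-only file settles, on the REAL tensor packet `V = ⊗_{ℚ_p} k_i` of abc-iut-S1/S8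
(`TensorPacketRing`, `TensorPacketVolume`: `ι_i`, `(R_I)~ = normalizedPacket`, the decomposition
`ψ : V ≃ ∏_j L_j`, `ψ((R_I)~) = ∏_j O_{L_j}`, the log-volume `packetLogVolume`), what those slot-twisted
regions `ι_i(q)·(R_I)~` ARE:

* `image_iota_smul_normalizedPacket` — `ψ(ι_i(q)·(R_I)~)` is the polydisc of the CONSTANT radius `‖q‖` in
  every factor `L_j` (every embedding `k_i → L_j` is an isometry, `norm_factorEmb`);
* `iota_smul_normalizedPacket_eq_of_norm_eq` — **twists of the same size at different slots give the same
  region**: `‖q‖ = ‖q′‖ ⇒ ι_i(q)·(R_I)~ = ι_{i′}(q′)·(R_I)~`. For a CONSTANT collection (one place `v` in every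
  slot — always the case when `V(F_mod)_p` is a singleton, e.g. `F_mod = ℚ`) the (Ind1)-moved twists
  `ι_{i†}(q_v^{j²})·(R_I)~`, `i† ∈ S±_{j+1}`, therefore all COINCIDE: the union over (Ind1) is the single
  region of the text and the symmetrization is exact;
* `iota_smul_normalizedPacket_subset_of_norm_le`, `…_union_eq_of_norm_le` — twists of DIFFERENT sizes give
  NESTED regions, the union being the one of the less divisible value (`‖q‖ ≤ ‖q′‖ ⇒ ι_i(q)·(R_I)~ ∪
  ι_{i′}(q′)·(R_I)~ = ι_{i′}(q′)·(R_I)~`);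
* `packetLogVolume_iota_smul_normalizedPacket` — `μ^log(ι_i(q)·(R_I)~) = log ‖q‖`, independent of the slot;
  hence `packetLogVolume_union_iota_smul` — the log-volume of the union of two slot-twists is
  `max(log ‖q‖, log ‖q′‖)`, which exceeds their average unless `‖q‖ = ‖q′‖` (`max_log_norm_gt_avg`).

So the per-collection quantity the hull of the union feeds into [IUTchIV] Step (v) is governed by the
LEAST divisible theta value of the collection; it equals the text's (last-slot / averaged) value exactly
for collections all of whose places carry theta values of the same size. [cite: Mochizuki2012, IUTchIV
Thm. 1.10 proof Step (v) pp. 27–28] Written by the wave-3 discharge seat abc-iut-c312-d1 (cell abc-iut).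
Nothing here takes a side on [IUTchIII] Cor. 3.12; typed ≠ endorsed.
-/

noncomputable section

open MeasureTheory Set Metric
open scoped Pointwise

namespace Literature.IUT.LogVolume

variable (p : ℕ) [Fact p.Prime]
variable {I : Type} [Fintype I] [DecidableEq I]
variable (k : I → Type) [∀ i, NontriviallyNormedField (k i)] [∀ i, NormedAlgebra ℚ_[p] (k i)]
variable {J : Type} [Fintype J] (L : J → Type) [∀ j, NontriviallyNormedField (L j)]
  [∀ j, NormedAlgebra ℚ_[p] (L j)]
variable (ψ : PacketAlgebra p k ≃ₐ[ℚ_[p]] (Π j, L j))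
variable [∀ i, IsUltrametricDist (k i)] [∀ i, ProperSpace (k i)] [Nonempty I]
  [∀ j, IsUltrametricDist (L j)] [∀ j, ProperSpace (L j)]

/-! ### The slot-twisted regions `ι_i(q)·(R_I)~` through the decomposition -/

omit [Fintype I] [Fintype J] [∀ i, IsUltrametricDist (k i)] [Nonempty I] [∀ j, IsUltrametricDist (L j)]
  [∀ j, ProperSpace (L j)] in
/-- The components of `ψ(ι_i(q))` all have norm `‖q‖` (isometric embeddings), in particular are nonzero
for `q ≠ 0`. [cite: Mochizuki2012, IUTchIV Prop. 1.4 (iii) proof p. 14] -/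
theorem psi_iota_apply_ne_zero (i : I) {q : k i} (hq : q ≠ 0) (j : J) : ψ (iota p k i q) j ≠ 0 := by
  rw [← norm_pos_iff, ← factorEmb_apply, norm_factorEmb p k L ψ i j q]
  exact norm_pos_iff.mpr hq

omit [Fintype J] in
/-- **`ψ(ι_i(q)·(R_I)~)` is the polydisc of constant radius `‖q‖`**: `= ∏_j closedBall(0, ‖q‖)`, whatever
the slot `i`. [cite: Mochizuki2012, IUTchIV Thm. 1.10 proof Step (v) pp. 27–28] -/
theorem image_iota_smul_normalizedPacket [Finite J] (i : I) {q : k i} (hq : q ≠ 0) :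
    ψ '' (iota p k i q • (normalizedPacket p k : Set (PacketAlgebra p k))) = polydisc L (fun _ => ‖q‖) := by
  have hg := psi_iota_apply_ne_zero p k L ψ i hq
  have h1 : ψ '' (iota p k i q • (normalizedPacket p k : Set (PacketAlgebra p k)))
      = (fun y => ψ (iota p k i q) * y) '' (ψ '' (normalizedPacket p k : Set (PacketAlgebra p k))) := by
    rw [← image_smul, image_image, image_image]
    exact image_congr fun a _ => by rw [smul_eq_mul, map_mul]
  rw [h1, image_normalizedPacket p k L ψ, ← hullSet_eq_image_mul L _ hg, hullSet]
  congr 1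
  funext j
  rw [← factorEmb_apply, norm_factorEmb p k L ψ i j q]

omit [Fintype J] in
include ψ in
/-- **Same size, same region.** Theta-twists of the same absolute value at ANY two slots (possibly
different factor fields) give the same translate of `(R_I)~`: `‖q‖ = ‖q′‖ ⇒ ι_i(q)·(R_I)~ = ι_{i′}(q′)·(R_I)~`.
For a constant collection the (Ind1)-moved twists `ι_{i†}(q_v^{j²})·(R_I)~` thus all coincide.
[cite: Mochizuki2012, IUTchIV Thm. 1.10 proof Step (v) pp. 27–28] -/
theorem iota_smul_normalizedPacket_eq_of_norm_eq [Finite J] (i i' : I) {q : k i} {q' : k i'} (hq : q ≠ 0)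
    (h : ‖q‖ = ‖q'‖) :
    iota p k i q • (normalizedPacket p k : Set (PacketAlgebra p k))
      = iota p k i' q' • (normalizedPacket p k : Set (PacketAlgebra p k)) := by
  have hq' : q' ≠ 0 := by rw [← norm_pos_iff, ← h]; exact norm_pos_iff.mpr hq
  apply (Set.image_injective.mpr ψ.injective)
  rw [image_iota_smul_normalizedPacket p k L ψ i hq, image_iota_smul_normalizedPacket p k L ψ i' hq', h]

omit [Fintype J] in
include ψ in
/-- **Different sizes, nested regions**: `‖q‖ ≤ ‖q′‖ ⇒ ι_i(q)·(R_I)~ ⊆ ι_{i′}(q′)·(R_I)~`.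
[cite: Mochizuki2012, IUTchIV Thm. 1.10 proof Step (v) pp. 27–28] -/
theorem iota_smul_normalizedPacket_subset_of_norm_le [Finite J] (i i' : I) {q : k i} {q' : k i'}
    (hq : q ≠ 0) (h : ‖q‖ ≤ ‖q'‖) :
    iota p k i q • (normalizedPacket p k : Set (PacketAlgebra p k))
      ⊆ iota p k i' q' • (normalizedPacket p k : Set (PacketAlgebra p k)) := by
  have hq' : q' ≠ 0 := by
    rw [← norm_pos_iff]; exact (norm_pos_iff.mpr hq).trans_le h
  intro x hx
  have hx' : ψ x ∈ ψ '' (iota p k i q • (normalizedPacket p k : Set (PacketAlgebra p k))) :=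
    mem_image_of_mem _ hx
  rw [image_iota_smul_normalizedPacket p k L ψ i hq] at hx'
  have hy : ψ x ∈ ψ '' (iota p k i' q' • (normalizedPacket p k : Set (PacketAlgebra p k))) := by
    rw [image_iota_smul_normalizedPacket p k L ψ i' hq']
    exact polydisc_mono L (fun _ => h) hx'
  obtain ⟨y, hy, hyx⟩ := hy
  rwa [← ψ.injective hyx]

omit [Fintype J] in
include ψ in
/-- The union of two slot-twists of sizes `‖q‖ ≤ ‖q′‖` IS the larger one (the less divisible twist).
[cite: Mochizuki2012, IUTchIV Thm. 1.10 proof Step (v) pp. 27–28] -/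
theorem iota_smul_normalizedPacket_union_eq_of_norm_le [Finite J] (i i' : I) {q : k i} {q' : k i'}
    (hq : q ≠ 0) (h : ‖q‖ ≤ ‖q'‖) :
    iota p k i q • (normalizedPacket p k : Set (PacketAlgebra p k))
        ∪ iota p k i' q' • (normalizedPacket p k : Set (PacketAlgebra p k))
      = iota p k i' q' • (normalizedPacket p k : Set (PacketAlgebra p k)) :=
  union_eq_self_of_subset_left (iota_smul_normalizedPacket_subset_of_norm_le p k L ψ i i' hq h)

/-! ### Their log-volumes -/

variable [∀ j, MeasurableSpace (L j)] [∀ j, BorelSpace (L j)]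

/-- **`μ^log(ι_i(q)·(R_I)~) = log ‖q‖`**, independent of the slot `i` (all factors have radius `‖q‖`; the
weights sum to `1`). [cite: Mochizuki2012, IUTchIV Thm. 1.10 proof Step (v) pp. 27–28] -/
theorem packetLogVolume_iota_smul_normalizedPacket [Nonempty J] (i : I) {q : k i} (hq : q ≠ 0) :
    packetLogVolume p k L ψ (iota p k i q • (normalizedPacket p k : Set (PacketAlgebra p k)))
      = Real.log ‖q‖ := by
  rw [packetLogVolume_smul_normalizedPacket p k L ψ _ (psi_iota_apply_ne_zero p k L ψ i hq)]
  have hn : ∀ j, ‖ψ (iota p k i q) j‖ = ‖q‖ := fun j => by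
    rw [← factorEmb_apply, norm_factorEmb p k L ψ i j q]
  simp_rw [hn]
  calc ∑ j, ((packetDegree p L : ℝ))⁻¹ *
        (((absRamificationIdx p (L j) : ℝ) * residueDegree p (L j)) * Real.log ‖q‖)
      = Real.log ‖q‖ * ∑ j, ((packetDegree p L : ℝ))⁻¹ *
          ((absRamificationIdx p (L j) : ℝ) * residueDegree p (L j)) := by
        rw [Finset.mul_sum]
        exact Finset.sum_congr rfl fun j _ => by ring
    _ = Real.log ‖q‖ := by rw [sum_weight_mul_degree p L, mul_one]

/-- **The union of two slot-twists has the log-volume of the LESS divisible one**: for `‖q‖ ≤ ‖q′‖`,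
`μ^log(ι_i(q)·(R_I)~ ∪ ι_{i′}(q′)·(R_I)~) = log ‖q′‖ = max(log ‖q‖, log ‖q′‖)`.
[cite: Mochizuki2012, IUTchIV Thm. 1.10 proof Step (v) pp. 27–28] -/
theorem packetLogVolume_union_iota_smul [Nonempty J] (i i' : I) {q : k i} {q' : k i'} (hq : q ≠ 0)
    (h : ‖q‖ ≤ ‖q'‖) :
    packetLogVolume p k L ψ
        (iota p k i q • (normalizedPacket p k : Set (PacketAlgebra p k))
          ∪ iota p k i' q' • (normalizedPacket p k : Set (PacketAlgebra p k)))
      = max (Real.log ‖q‖) (Real.log ‖q'‖) := by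
  have hq' : q' ≠ 0 := by
    rw [← norm_pos_iff]; exact (norm_pos_iff.mpr hq).trans_le h
  rw [iota_smul_normalizedPacket_union_eq_of_norm_le p k L ψ i i' hq h,
    packetLogVolume_iota_smul_normalizedPacket p k L ψ i' hq',
    max_eq_right (Real.log_le_log (norm_pos_iff.mpr hq) h)]

omit [Fact p.Prime] [Fintype I] [DecidableEq I] [∀ i, NormedAlgebra ℚ_[p] (k i)] [Fintype J]
  [∀ j, NormedAlgebra ℚ_[p] (L j)] [∀ i, IsUltrametricDist (k i)] [∀ i, ProperSpace (k i)] [Nonempty I]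
  [∀ j, IsUltrametricDist (L j)] [∀ j, ProperSpace (L j)] [∀ j, MeasurableSpace (L j)]
  [∀ j, BorelSpace (L j)] in
/-- … and the maximum STRICTLY exceeds the symmetrized (averaged) value as soon as the two sizes differ:
`‖q‖ < ‖q′‖ ⇒ (log ‖q‖ + log ‖q′‖)/2 < max(log ‖q‖, log ‖q′‖)` — the sense in which "symmetrizing with
respect to the choice of i†" undercounts the hull of the union over (Ind1) for a collection mixing two
sizes. [cite: Mochizuki2012, IUTchIV Thm. 1.10 proof Step (v) pp. 27–28] -/
theorem max_log_norm_gt_avg (i i' : I) {q : k i} {q' : k i'} (hq : q ≠ 0) (h : ‖q‖ < ‖q'‖) :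
    (Real.log ‖q‖ + Real.log ‖q'‖) / 2 < max (Real.log ‖q‖) (Real.log ‖q'‖) := by
  have hlt : Real.log ‖q‖ < Real.log ‖q'‖ := Real.log_lt_log (norm_pos_iff.mpr hq) h
  rw [max_eq_right hlt.le]
  linarith

end Literature.IUT.LogVolume

end
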